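import Mathlib
import Summits.ResolutionOfSingularities.ResolutionOfSingularities.Theses.PAlteration
import Summits.ResolutionOfSingularities.ResolutionOfSingularities.Theses.Valuative
import Summits.ResolutionOfSingularities.ResolutionOfSingularities.Theorems.PAlterationPicoverLocalModelCases
import Summits.ResolutionOfSingularities.ResolutionOfSingularities.Theorems.ValuativeLuAlphaPTorsorBirationalExit
import Literature.AlgebraicGeometry.Resolution.ResolutionLU
import Literature.AlgebraicGeometry.Resolution.FieldsJ2
import Literature.AlgebraicGeometry.Resolution.QuasiExcellentLocalization
import Literature.AlgebraicGeometry.Resolution.ResolutionOfComponents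

/-!
# ResolutionOfSingularities — `PicoverLocalModel → LuAlphaPTorsor`
(supports stmt-ResolutionOfSingularities-0557; a cross-route implication to stmt-0641)

The crux `PicoverLocalModel` of route `pAlteration` (stmt-0557: for `k` of characteristic `p`,
`R` a regular finitely generated `k`-domain and `a ∈ R`, the reduced local model
`Spec ((R[T]/(T^p - a))_red)` has a resolution) IMPLIES the crux `LuAlphaPTorsor` of route
`Valuative` (stmt-0641: relative local uniformization of `α_p`-torsors `t ^ p = a` over bases
regular at the centre of a valuation). Consequently the Valuative deciding chain
`LuAlphaPTorsor → TorsorToLurel → PatchingRel → ResolutionOfSingularities` can equally be fed by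
`PicoverLocalModel`, and (with `picoverLocalModel_of_picover`) by `Picover`.

Proof (`luAlphaPTorsor_of_picoverLocalModel`). Given `A₀ ⊆ O` finitely generated, regular at
the centre `𝔭 = 𝔪_O ∩ A₀`, and `t` with `t ^ p ∈ A₀`, `Frac (A₀[t]) = K`:
1. `exists_isRegularRing_away_of_isRegularLocalRing`: the regular locus of the finite type
   `k`-algebra `A₀` is open (Nagata–Grothendieck, in-tree `isOpen_regularLocus_of_finiteType_field`),
   so some basic open `D(g) ∋ 𝔭` is regular: `R := A₀[1/g]` is a regular finitely generated
   `k`-domain, and `R ⊆ O` because `g` is a unit of `O`.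
2. `ker_lift_eq_nilradical` / `nonempty_quotientNilradical_ringEquiv_range`: with `a := t ^ p ∈ R`,
   the map `R[T]/(T^p - a) → K`, `T ↦ t`, has kernel the nilradical (two primes over `(0)` of `R`
   in an integral extension, one inside the other, coincide), so `(R[T]/(T^p - a))_red ≅ R[t] ⊆ K`,
   a finitely generated model `B = A₀[g⁻¹, t] ⊆ O` of `K` containing `A₀[t]`.
3. The hypothesis resolves `Spec B`; the in-tree `exists_affineModel_regular_of_hasResolution`
   (valuative criterion of properness + an affine chart at the centre) gives a finitely generated
   `B ⊆ A ⊆ O` regular at the centre, which is the conclusion of `LuAlphaPTorsor`.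
-/

-- `Summit.<Summit>.<Sub>.Theorems` with `Sub = Summit` (single-conjunct summit, D-0017): the
-- duplicated namespace component is the tree layout.
set_option linter.dupNamespace false

namespace Summit.ResolutionOfSingularities.ResolutionOfSingularities.Theorems

open Polynomial AlgebraicGeometry CategoryTheory Literature.AlgebraicGeometry.Resolution

universe u

/-! ## A regular neighbourhood of a regular point of an affine `k`-scheme of finite type -/

section RegularNeighbourhood

/-- **Regular points have regular affine neighbourhoods.** For a finitely generated algebra `B`
over a field `k` and a prime `P` with `B_P` regular, some basic open `D(g) ∋ P` is regular, i.e.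
`B[1/g]` is a regular ring for some `g ∉ P`: the regular locus of `B` is open
(Nagata–Grothendieck, in-tree `isOpen_regularLocus_of_finiteType_field`) and the local rings of
`B[1/g]` are those of `B` at the primes of `D(g)`. [cite: Matsumura1987, §30, Cor. to Thm. 30.5] -/
theorem exists_isRegularRing_away_of_isRegularLocalRing {k B : Type u} [Field k] [CommRing B]
    [Algebra k B] [Algebra.FiniteType k B] (P : Ideal B) [P.IsPrime]
    (hP : IsRegularLocalRing (Localization.AtPrime P)) :
    ∃ g : B, g ∉ P ∧ IsRegularRing (Localization.Away g) := by
  have hopen := isOpen_regularLocus_of_finiteType_field k B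
  have hmem : (⟨P, ‹_›⟩ : PrimeSpectrum B) ∈ regularLocus B := hP
  obtain ⟨_, ⟨g, rfl⟩, hgP, hg⟩ :=
    PrimeSpectrum.isTopologicalBasis_basic_opens.exists_subset_of_mem_open hmem hopen
  refine ⟨g, hgP, ?_⟩
  haveI : IsNoetherianRing B := Algebra.FiniteType.isNoetherianRing k B
  haveI : IsNoetherianRing (Localization.Away g) :=
    IsLocalization.isNoetherianRing (Submonoid.powers g) _ inferInstance
  refine isRegularRing_iff.mpr fun Q _ => ?_
  have hQ := (mem_regularLocus_iff_comap_of_isLocalization (Submonoid.powers g)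
    (⟨Q, ‹_›⟩ : PrimeSpectrum (Localization.Away g))).mpr (hg ?_)
  · exact hQ
  · change g ∉ Q.comap (algebraMap B (Localization.Away g))
    rw [Ideal.mem_comap]
    exact fun h => Ideal.IsPrime.ne_top ‹_› (Ideal.eq_top_of_isUnit_mem _ h
      (IsLocalization.Away.algebraMap_isUnit g))

end RegularNeighbourhood

/-! ## `(R[T]/(T^p - a))_red ≅ R[t]` for a `p`-th root `t` of `a` in a field -/

section ToField

variable {p : ℕ} [hp : Fact p.Prime] {R : Type u} [CommRing R] {L : Type u} [Field L]

omit hp in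
/-- `T ↦ t` defines `R[T]/(T^p - a) → L` when `t ^ p = i a` in `L`. [folklore] -/
theorem eval₂_X_pow_sub_C_eq_zero (i : R →+* L) {t : L} {a : R} (h : t ^ p = i a) :
    (X ^ p - C a).eval₂ i t = 0 := by
  rw [eval₂_sub, eval₂_X_pow, eval₂_C, h, sub_self]

/-- **The kernel of `R[T]/(T^p - a) → L`, `T ↦ t` (`t^p = a`), is the nilradical**, for a domain
`R ⊆ L` of characteristic `p`: it is a prime lying over `(0)` (as `R → L` is injective) and
contains the nilradical, itself a prime over `(0)` (`isPrime_nilradical_adjoinRoot_X_pow_sub_C`);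
incomparability for the integral extension `R ⊆ R[T]/(T^p - a)` forces equality. [folklore] -/
theorem ker_lift_eq_nilradical [IsDomain R] [CharP R p] (i : R →+* L)
    (hi : Function.Injective i) {t : L} {a : R} (h : t ^ p = i a) :
    RingHom.ker (AdjoinRoot.lift i t (eval₂_X_pow_sub_C_eq_zero i h)) =
      nilradical (AdjoinRoot (X ^ p - C a)) := by
  haveI := isPrime_nilradical_adjoinRoot_X_pow_sub_C (p := p) a
  haveI := finite_adjoinRoot_X_pow_sub_C (p := p) a
  have hle : nilradical (AdjoinRoot (X ^ p - C a)) ≤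
      RingHom.ker (AdjoinRoot.lift i t (eval₂_X_pow_sub_C_eq_zero i h)) := by
    intro x hx
    rw [RingHom.mem_ker]
    exact ((mem_nilradical.mp hx).map _).eq_zero
  refine le_antisymm ?_ hle
  by_contra hne
  have hlt : nilradical (AdjoinRoot (X ^ p - C a)) <
      RingHom.ker (AdjoinRoot.lift i t (eval₂_X_pow_sub_C_eq_zero i h)) :=
    lt_of_le_of_ne hle fun heq => hne (heq ▸ le_rfl)
  have hcomap := Ideal.IsIntegral.comap_lt_comap (R := R) hlt
  have hbot : (RingHom.ker (AdjoinRoot.lift i t (eval₂_X_pow_sub_C_eq_zero i h))).comap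
      (algebraMap R (AdjoinRoot (X ^ p - C a))) = ⊥ := by
    rw [AdjoinRoot.algebraMap_eq, RingHom.comap_ker, ← RingHom.injective_iff_ker_eq_bot]
    intro x y hxy
    simp only [RingHom.comp_apply, AdjoinRoot.lift_of] at hxy
    exact hi hxy
  rw [hbot] at hcomap
  exact not_lt_bot hcomap

/-- **`(R[T]/(T^p - a))_red ≅ R[t] ⊆ L`**: for a domain `R ⊆ L` of characteristic `p` and a
`p`-th root `t ∈ L` of `a`, the reduced local-model ring is isomorphic to the subring of `L`
generated by `R` and `t` (the image of `T ↦ t`; stated as `Nonempty` of a ring isomorphism, the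
isomorphism being `Ideal.quotEquivOfEq ≫ RingHom.quotientKerEquivRange`). [folklore] -/
theorem nonempty_quotientNilradical_ringEquiv_range [IsDomain R] [CharP R p] (i : R →+* L)
    (hi : Function.Injective i) {t : L} {a : R} (h : t ^ p = i a) :
    Nonempty ((AdjoinRoot (X ^ p - C a) ⧸ nilradical (AdjoinRoot (X ^ p - C a))) ≃+*
      (AdjoinRoot.lift i t (eval₂_X_pow_sub_C_eq_zero i h)).range) :=
  ⟨(Ideal.quotEquivOfEq (ker_lift_eq_nilradical i hi h).symm).trans
    (RingHom.quotientKerEquivRange _)⟩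

end ToField

/-! ## `PicoverLocalModel → LuAlphaPTorsor` -/

section ToLuAlphaPTorsor

variable {k K : Type} [Field k] [Field K] [Algebra k K]

/-- **`PicoverLocalModel` implies `LuAlphaPTorsor`** (crux `stmt-ResolutionOfSingularities-0557`
of route `pAlteration` implies crux `stmt-ResolutionOfSingularities-0641` of route `Valuative`):
relative local uniformization of `α_p`-torsors `t ^ p = a` over bases regular at the centre
follows from resolution of the local models `Spec ((R[T]/(T^p - a))_red)` over regular affine
bases. Proof: shrink the base `A₀` to a regular basic open neighbourhood `R = A₀[1/g]` of the
centre (`g ∉ 𝔪_O`, so `R ⊆ O`; openness of the regular locus); the reduced local model over `R`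
is `R[t] ⊆ K` (`nonempty_quotientNilradical_ringEquiv_range`), a finitely generated model of `K` inside `O`
containing `A₀[t]`; a resolution of `Spec R[t]` (the hypothesis) yields, by the valuative criterion
of properness and an affine chart at the centre (in-tree
`exists_affineModel_regular_of_hasResolution`), a finitely generated `R[t] ⊆ A ⊆ O` regular at the
centre. [folklore] -/
theorem luAlphaPTorsor_of_picoverLocalModel
    (hLM : Summit.ResolutionOfSingularities.ResolutionOfSingularities.Theses.PAlteration.PicoverLocalModel) :
    Summit.ResolutionOfSingularities.ResolutionOfSingularities.Theses.Valuative.LuAlphaPTorsor := by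
  unfold Summit.ResolutionOfSingularities.ResolutionOfSingularities.Theses.Valuative.LuAlphaPTorsor
  intro p hp k K _ _ _ _ O A₀ h₀ t hfg htp hfr hreg
  classical
  haveI : Fact p.Prime := ⟨hp⟩
  -- the base `B := A₀` as a finitely generated `k`-domain, and its centre `P`
  set P : Ideal A₀.toSubring := Ideal.comap (Subring.inclusion h₀) (IsLocalRing.maximalIdeal O)
    with hPdef
  haveI hPprime : P.IsPrime := Ideal.IsPrime.comap _
  letI : Algebra k A₀.toSubring := inferInstanceAs (Algebra k A₀)
  haveI : IsScalarTower k A₀.toSubring K := inferInstanceAs (IsScalarTower k A₀ K)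
  haveI : Algebra.FiniteType k A₀.toSubring := (A₀.fg_iff_finiteType).mp hfg
  -- Step 1: a regular basic open neighbourhood `R = A₀[1/g]` of the centre
  obtain ⟨g, hgP, hRreg⟩ := exists_isRegularRing_away_of_isRegularLocalRing (k := k) P hreg
  have hg1 : O.valuation (g : K) = 1 := (mem_primeCompl_centre_iff O A₀ h₀ g).mp hgP
  have hg0 : (g : A₀.toSubring) ≠ 0 := by
    rintro rfl
    exact hgP (Ideal.zero_mem P)
  set R := Localization.Away g with hRdef
  haveI : IsDomain R :=
    IsLocalization.isDomain_localization (powers_le_nonZeroDivisors_of_noZeroDivisors hg0)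
  haveI : Algebra.FiniteType k R :=
    (‹Algebra.FiniteType k A₀.toSubring›).trans
      (IsLocalization.finiteType_of_monoid_fg (Submonoid.powers g) R)
  -- the embedding `φ : R → K`
  have hunits : ∀ y : Submonoid.powers g, IsUnit (A₀.toSubring.subtype y) := by
    rintro ⟨y, n, rfl⟩
    simp only [map_pow]
    exact (isUnit_iff_ne_zero.mpr fun h => hg0 (Subtype.ext h)).pow n
  set φ : R →+* K := IsLocalization.lift (M := Submonoid.powers g) hunits with hφdef
  have hφalg : ∀ x : A₀.toSubring, φ (algebraMap A₀.toSubring R x) = x := fun x =>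
    IsLocalization.lift_eq hunits x
  have hφinj : Function.Injective φ := by
    rw [hφdef, IsLocalization.lift_injective_iff]
    intro x y
    constructor
    · intro hxy
      exact congrArg _ ((IsLocalization.injective R
        (powers_le_nonZeroDivisors_of_noZeroDivisors hg0)) hxy)
    · intro hxy
      exact congrArg _ (A₀.toSubring.subtype_injective hxy)
  have hφS : ∀ S : Subring K, (A₀ : Set K) ⊆ S → (g : K)⁻¹ ∈ S → ∀ r : R, φ r ∈ S := by
    intro S hA₀S hgS r
    obtain ⟨⟨b, s⟩, hbs⟩ := IsLocalization.mk'_surjective (M := Submonoid.powers g) r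
    simp only at hbs
    subst hbs
    obtain ⟨n, hn⟩ := (Submonoid.mem_powers_iff _ _).mp s.2
    have hspec := IsLocalization.mk'_spec R b s
    have hsK : ((s : A₀.toSubring) : K) = (g : K) ^ n := by
      rw [← SubmonoidClass.coe_pow, hn]
    have hgn0 : ((g : K)) ^ n ≠ 0 := pow_ne_zero n fun h => hg0 (Subtype.ext h)
    have hval : φ (IsLocalization.mk' R b s) = (b : K) * ((g : K) ^ n)⁻¹ := by
      rw [eq_mul_inv_iff_mul_eq₀ hgn0, ← hsK]
      have := congrArg φ hspec
      rw [map_mul, hφalg, hφalg] at this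
      exact this
    rw [hval]
    refine S.mul_mem (hA₀S b.2) ?_
    rw [← inv_pow]
    exact S.pow_mem hgS n
  have hgO : (g : K)⁻¹ ∈ O := inv_mem_of_valuation_eq_one O hg1
  have htO : t ∈ O := PfaffLine.mem_valuationSubring_of_pow_mem O hp.ne_zero (h₀ htp)
  -- Step 2: the local model over `R` and its image `R[t] ⊆ K`
  set a : R := algebraMap A₀.toSubring R ⟨t ^ p, htp⟩ with hadef
  have hta : t ^ p = φ a := by rw [hadef, hφalg]
  haveI : CharP R p := charP_of_algebra_field k R
  set ψ : AdjoinRoot (X ^ p - C a) →+* K :=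
    AdjoinRoot.lift φ t (eval₂_X_pow_sub_C_eq_zero φ hta) with hψdef
  have hψS : ∀ S : Subring K, (A₀ : Set K) ⊆ S → (g : K)⁻¹ ∈ S → t ∈ S → ∀ x, ψ x ∈ S := by
    intro S hA₀S hgS htS x
    induction x using AdjoinRoot.induction_on with
    | ih q =>
      rw [hψdef, AdjoinRoot.lift_mk, eval₂_eq_sum]
      exact sum_mem fun n _ => S.mul_mem (hφS S hA₀S hgS _) (S.pow_mem htS n)
  -- `B := R[t]` as a `k`-subalgebra of `K`
  let B : Subalgebra k K :=
    { ψ.range with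
      algebraMap_mem' := fun c => ⟨AdjoinRoot.of _ (algebraMap A₀.toSubring R (algebraMap k _ c)),
        by rw [hψdef, AdjoinRoot.lift_of, hφalg]; rfl⟩ }
  have hBO : B.toSubring ≤ O.toSubring := by
    rintro x ⟨y, rfl⟩
    exact hψS O.toSubring (fun z hz => h₀ hz) hgO htO y
  have hA₀B : A₀ ≤ B := fun x hx =>
    ⟨AdjoinRoot.of _ (algebraMap A₀.toSubring R ⟨x, hx⟩), by rw [hψdef, AdjoinRoot.lift_of, hφalg]⟩
  have htB : t ∈ B := ⟨AdjoinRoot.root _, by rw [hψdef, AdjoinRoot.lift_root]⟩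
  have hadjB : Algebra.adjoin k (insert t (A₀ : Set K)) ≤ B :=
    Algebra.adjoin_le (Set.insert_subset htB hA₀B)
  haveI : IsFractionRing B K := by
    haveI := hfr
    exact isFractionRing_subalgebra_of_le _ B hadjB
  -- `B = A₀[g⁻¹, t]` is finitely generated
  have hginvB : (g : K)⁻¹ ∈ B := by
    refine ⟨AdjoinRoot.of _ (IsLocalization.mk' R 1 ⟨g, Submonoid.mem_powers g⟩), ?_⟩
    rw [hψdef, AdjoinRoot.lift_of]
    have hspec := IsLocalization.mk'_spec R (1 : A₀.toSubring) ⟨g, Submonoid.mem_powers g⟩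
    have := congrArg φ hspec
    rw [map_mul, hφalg, hφalg, OneMemClass.coe_one] at this
    exact eq_inv_of_mul_eq_one_left this
  have hBle : B ≤ Algebra.adjoin k (insert t (insert (g : K)⁻¹ (A₀ : Set K))) := by
    rintro x ⟨y, rfl⟩
    refine hψS (Algebra.adjoin k (insert t (insert (g : K)⁻¹ (A₀ : Set K)))).toSubring
      (fun z hz => Algebra.subset_adjoin (Set.mem_insert_of_mem _ (Set.mem_insert_of_mem _ hz)))
      (Algebra.subset_adjoin (Set.mem_insert_of_mem _ (Set.mem_insert _ _)))
      (Algebra.subset_adjoin (Set.mem_insert _ _)) y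
  have hleB : Algebra.adjoin k (insert t (insert (g : K)⁻¹ (A₀ : Set K))) ≤ B :=
    Algebra.adjoin_le (Set.insert_subset htB (Set.insert_subset hginvB hA₀B))
  have hBfg : B.FG := by
    rw [le_antisymm hBle hleB]
    have h1 : (Algebra.adjoin k (insert (g : K)⁻¹ (A₀ : Set K))).FG := PfaffLine.fg_adjoin_insert hfg _
    have h2 := PfaffLine.fg_adjoin_insert h1 t
    rwa [Algebra.adjoin_insert_adjoin] at h2
  -- Step 3: the hypothesis resolves `Spec B ≅ Spec ((R[T]/(T^p - a))_red)`
  have hres : Scheme.HasResolution (Spec (.of B)) := by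
    have h0 := hLM p hp k R ‹_› hRreg a
    obtain ⟨e⟩ := nonempty_quotientNilradical_ringEquiv_range φ hφinj hta
    exact Scheme.HasResolution.of_iso (Spec.map e.symm.toCommRingCatIso.hom) h0
  -- Step 4: an affine regular model at the centre above `B`
  obtain ⟨A, hAO, hBA, hAfg, hAreg⟩ := exists_affineModel_regular_of_hasResolution O B hBO hBfg
    ‹_› hres
  exact ⟨A, hAO, hA₀B.trans hBA, hBA htB, hAfg, isFractionRing_subalgebra_of_le B A hBA, hAreg⟩

end ToLuAlphaPTorsor

end Summit.ResolutionOfSingularities.ResolutionOfSingularities.Theorems
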